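import Summits.HodgeConjecture.CorCM.MumfordTateRankSevenTypeThreeFactor
import Summits.HodgeConjecture.CorCM.MumfordTateRankSevenQuaternionConverse
import Summits.HodgeConjecture.CorCM.MumfordTateRankSevenSplitConverse
import HarnessLib

/-!
# The rung `dim MT(H¹(X)) = 7` with `𝔷 = 0` AS AN IFF: the four isogeny shapes (split, type III, real multiplication,
# quaternion fourfold) characterise `dim MT(H¹X) = 7 ∧ Lie Hg ∩ End_Hdg = 0`

COR-CM (cell `pub-hodgecm2`, seat `b27` gen 42, count-neutral Mumford–Tate-rank ladder; theorems only, no definition, no named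
fact; UNCONDITIONAL — nothing here uses or asserts HC_CM).  Capstone of the `t = 7` files: FORWARD = `shape_of_center_eq_bot_of_mtRank_eq_seven`
(`CorCM/MumfordTateRankSevenTypeThreeFactor`, gens 39–42); BACKWARD = the four converses — split (`MumfordTateRankSevenSplitConverse`,
gen 42), type III (the shape records `dim MT(H¹B) = 7` of the simple factor, transported to `X ∼ B^{m+1}` by
`mtRank_hodge_one_eq_of_isIsogenous_biproduct_const`, `𝔷 = 0` from the centre `ℚ`), real multiplication
(`mtRank_hodge_one_eq_seven_of_isIsogenous_powSucc_rmSurface`, gen 40), quaternion fourfold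
(`mtRank_hodge_one_eq_seven_of_isIsogenous_powSucc_quaternionFourfold`, gen 42).

* **`mtRank_eq_seven_and_center_eq_bot_iff_shape`** — for `0 < dim X`:
  `dim MT(H¹X) = 7 ∧ 𝔷 = 0 ⟺ (i) ∨ (ii) ∨ (iii) ∨ (iv)`.

## References

* [MoonenZarhin1999LowDim] B. Moonen, Yu. Zarhin, *Hodge classes on abelian varieties of low dimension*, Math. Ann.
  315 (1999), §1, §2 (2.1)–(2.3), §3 (3.1) and Cor. (3.7).
* [MumfordAV1970] D. Mumford, *Abelian Varieties* (1970), §19 Thm. 1, Cor. 1–2 (pp. 173–174), §21.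
-/

noncomputable section

open scoped TensorProduct
open CategoryTheory CategoryTheory.Limits Module

namespace Summit.HodgeConjecture.CorCM

open Literature.AlgebraicGeometry.Motives
open Literature.AlgebraicGeometry.Motives.AbelianVariety
open Literature.AlgebraicGeometry.Motives.HodgeStructure
open Literature.AlgebraicGeometry.HodgeTheory
open Literature.AlgebraicGeometry.ComplexMultiplication (EndField isIsogenous_biproduct_powSucc)
open Literature.AlgebraicGeometry.Milne1999 (IsOfCMType)
open Literature.AlgebraicGeometry.Pohlmann1968 (isIsogenous_powSucc_biproduct)

variable [HodgeTensorFacts.{0, 0}] {X : AbelianVariety ℂ} {n : ℕ}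

/-- **The rung `dim MT(H¹X) = 7`, `𝔷 = 0`, as an IFF.**  For a complex abelian variety `X` with `0 < dim X`:
`dim MT(H¹X) = 7` and `Lie Hg(H¹X) ∩ End_Hdg(H¹X) = 0` **if and only if** `X` has one of the four shapes
(i) `X ∼ B₁^{a+1} × B₂^{b+1}`, `B₁ ≁ B₂` simple non-CM elliptic curves / quaternion surfaces with centre `ℚ`;
(ii) `X ∼ B^{m+1}`, `B` simple with `dim MT(H¹B) = 7`, `Z(End⁰B) = ℚ`, `(dim B, dim_ℚ End⁰B) ∈ {(4,4), (8,16)}` (type III);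
(iii) `X ∼ B^{m+1}`, `B` a simple surface with real multiplication by a real quadratic field;
(iv) `X ∼ B^{m+1}`, `B` a simple fourfold with `dim_ℚ End⁰B = 8` and real quadratic centre.
[cite: MoonenZarhin1999LowDim, §1, §2 (2.1)–(2.3), §3 (3.1) and Cor. (3.7)] [cite: MumfordAV1970, §19 Thm. 1, Cor. 1–2 (pp. 173–174) and §21] -/
theorem mtRank_eq_seven_and_center_eq_bot_iff_shape (hX : IsSmoothProjective n X.X) (h0 : 0 < X.dim) :
    haveI := BettiUniverse.finite hX 1
    ((BettiUniverse.hodge exists_isReal_hodgeModel_holds hX 1).mtRank = 7 ∧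
      (BettiUniverse.hodge exists_isReal_hodgeModel_holds hX 1).hodgeLie ⊓
        Subalgebra.toSubmodule (BettiUniverse.hodge exists_isReal_hodgeModel_holds hX 1).endAlg = ⊥) ↔
    ((∃ (B₁ B₂ : AbelianVariety ℂ) (a b : ℕ), B₁.IsSimple ∧ B₂.IsSimple ∧ 0 < B₁.dim ∧ B₁.dim ≤ 2 ∧ 0 < B₂.dim ∧
        B₂.dim ≤ 2 ∧ ¬ IsOfCMType B₁ ∧ ¬ IsOfCMType B₂ ∧
        Module.finrank ℚ B₁.endAlgebra = B₁.dim ^ 2 ∧ Module.finrank ℚ (Subalgebra.center ℚ B₁.endAlgebra) = 1 ∧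
        Module.finrank ℚ B₂.endAlgebra = B₂.dim ^ 2 ∧ Module.finrank ℚ (Subalgebra.center ℚ B₂.endAlgebra) = 1 ∧
        (∀ f : B₁ ⟶ B₂, f = 0) ∧ (∀ f : B₂ ⟶ B₁, f = 0) ∧ ¬ IsIsogenous B₁ B₂ ∧
        IsIsogenous X ((B₁.powSucc a).prod (B₂.powSucc b)) ∧ (a + 1) * B₁.dim + (b + 1) * B₂.dim = X.dim ∧
        ¬ IsOfCMType X) ∨
      (∃ (B : AbelianVariety ℂ) (m k : ℕ), B.IsSimple ∧ 0 < B.dim ∧ IsIsogenous X (⨁ fun _ : Fin (m + 1) => B) ∧ 0 < k ∧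
        X.dim = 4 * k ∧ X.dim = (m + 1) * B.dim ∧ Module.finrank ℚ X.endAlgebra = 4 * k ^ 2 ∧
        Module.finrank ℚ X.endAlgebra = (m + 1) ^ 2 * Module.finrank ℚ B.endAlgebra ∧
        Module.finrank ℚ (Subalgebra.center ℚ B.endAlgebra) = 1 ∧
        4 * Module.finrank ℚ B.endAlgebra = B.dim ^ 2 ∧
        (haveI := BettiUniverse.finite (AbelianVariety.isSmoothProjective_holds (A := B)) 1
         (BettiUniverse.hodge exists_isReal_hodgeModel_holds (AbelianVariety.isSmoothProjective_holds (A := B)) 1).mtRank =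
           7) ∧
        ((B.dim = 4 ∧ Module.finrank ℚ B.endAlgebra = 4) ∨ (B.dim = 8 ∧ Module.finrank ℚ B.endAlgebra = 16))) ∨
      (∃ (B : AbelianVariety ℂ) (m : ℕ) (hF : IsField B.endAlgebra),
        B.IsSimple ∧ B.dim = 2 ∧ Module.finrank ℚ B.endAlgebra = 2 ∧ NumberField.IsTotallyReal (EndField B hF) ∧
        IsIsogenous X (B.powSucc m) ∧ X.dim = (m + 1) * 2 ∧ Module.finrank ℚ X.endAlgebra = (m + 1) ^ 2 * 2 ∧
        IsStablyNondegenerate X ∧ ∀ N : ℕ, HodgeConjectureFor (X.powSucc N).dim (X.powSucc N).X) ∨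
      (∃ (B : AbelianVariety ℂ) (m : ℕ) (φ : B.endAlgebra) (q : ℚ),
        B.IsSimple ∧ B.dim = 4 ∧ Module.finrank ℚ B.endAlgebra = 8 ∧
        Module.finrank ℚ (Subalgebra.center ℚ B.endAlgebra) = 2 ∧ φ ∈ Subalgebra.center ℚ B.endAlgebra ∧ 0 < q ∧
        ¬ IsSquare q ∧ φ * φ = algebraMap ℚ B.endAlgebra q ∧
        (∀ z ∈ Subalgebra.center ℚ B.endAlgebra, ∃ a b : ℚ, z = algebraMap ℚ B.endAlgebra a + b • φ) ∧
        IsIsogenous X (B.powSucc m) ∧ X.dim = (m + 1) * 4 ∧ Module.finrank ℚ X.endAlgebra = (m + 1) ^ 2 * 8)) := by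
  classical
  haveI := BettiUniverse.finite hX 1
  constructor
  · rintro ⟨h7, hz⟩
    exact shape_of_center_eq_bot_of_mtRank_eq_seven hX h0 hz h7
  · rintro (h | h | h | h)
    · -- (i) split
      obtain ⟨B₁, B₂, a, b, hB₁s, hB₂s, hB₁0, hB₁2, hB₂0, hB₂2, hB₁cm, hB₂cm, hE₁, hZ₁, hE₂, hZ₂, -, -, h12, hXB, -, -⟩ := h
      obtain ⟨h7, -, hz, -⟩ := mtRank_hodge_one_eq_seven_of_isIsogenous_powSucc_prod_powSucc hX hB₁s hB₂s hB₁0 hB₁2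
        hB₂0 hB₂2 hB₁cm hB₂cm hE₁ hZ₁ hE₂ hZ₂ h12 hXB
      exact ⟨h7, hz⟩
    · -- (ii) type III: `t(X) = t(B) = 7`, `𝔷 = 0` from the centre `ℚ` of `End⁰B`
      obtain ⟨B, m, -, -, hB0, hXB, -, -, -, -, -, hZB, -, h7B, -⟩ := h
      have hB : IsSmoothProjective B.dim B.X := AbelianVariety.isSmoothProjective_holds
      refine ⟨?_, ?_⟩
      · rw [mtRank_hodge_one_eq_of_isIsogenous_biproduct_const hX hB hB0 hXB]
        exact h7B
      · have hA4B : HasNoTypeIVFactor B :=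
          hasNoTypeIVFactor_of_center_le_bot (le_of_eq (Subalgebra.eq_bot_of_finrank_one hZB))
        have hA4 : HasNoTypeIVFactor X :=
          (hA4B.powSucc m).of_isIsogenous (hXB.trans (isIsogenous_biproduct_powSucc B m))
        exact hodgeLie_hodge_one_inf_endAlg_eq_bot_of_hasNoTypeIVFactor hX hA4
    · -- (iii) real multiplication
      obtain ⟨B, m, -, hBs, hB2, hE2, -, hXB, -⟩ := h
      obtain ⟨h7, -, hz, -, -⟩ := mtRank_hodge_one_eq_seven_of_isIsogenous_powSucc_rmSurface hX hBs hB2 hE2 hXB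
      exact ⟨h7, hz⟩
    · -- (iv) quaternion fourfold
      obtain ⟨B, m, φ, q, hBs, hB4, hE8, -, -, hq, -, hφ, hZ, hXB, -, -⟩ := h
      obtain ⟨h7, -, hz, -, -⟩ :=
        mtRank_hodge_one_eq_seven_of_isIsogenous_powSucc_quaternionFourfold hX hBs hB4 hE8 hq.le hφ hZ hXB
      exact ⟨h7, hz⟩

end Summit.HodgeConjecture.CorCM

end
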